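import Summits.HodgeConjecture.CorCM.MumfordTateRankCMThreefoldTimesCMCurvesExact
import Summits.HodgeConjecture.CorCM.MumfordTateRankCMProductMonotone
import Summits.HodgeConjecture.CorCM.MumfordTateRankProductsOfCurves
import HarnessLib

/-!
# Simple CM abelian THREEFOLD × any number of pairwise non-isogenous CM elliptic curves: `t(T × E₀ × ⋯ × E_m) = m + 5` iff no curve field maps to
# `K = End⁰T`, and `= m + 4` otherwise (Moonen–Zarhin 1999 Thm. (0.2) (a)/(4) with a CM threefold, `m + 1` curves at once)

COR-CM (cell `pub-hodgecm2`, seat `b27` gen 51, count-neutral Mumford–Tate-rank ladder; theorems only, no definition, no named fact;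
UNCONDITIONAL — nothing here uses or asserts HC_CM).  Notation `t(X) = dim MT(H¹X)`; `T` a simple abelian threefold of CM type (`K = End⁰T` sextic,
`t(T) = 4`).

Gen 50's `CorCM/MumfordTateRankCMThreefoldTimesCMCurves` treated TWO curves.  Here seat b16's criterion `isNondegenerateFamily_iff_forall_isEmpty_of_finrank_le_six`
(ANY number of pairwise non-isogenous CM elliptic curves and ONE simple CM variety on a field of degree `≤ 6`: nondegenerate iff NO curve field embeds)
is transported to abstract varieties for the family `F = (T, E₀, …, E_m)` (`Fin.cons`), exactly as there: realise every simple CM factor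
(`Pohlmann1968.exists_realisation_mtRank_eq`), carry `X ∼ T × ⨁E ∼ ⨁F'` along the isogenies, read nondegeneracy as `t(X) = Σ dim + 1 = m + 5`
(`isNondegenerateFamily_iff_mtRank_hodge_one_eq`), and read «`K_a ↪ K_0`» as «`End⁰E_j → End⁰T`» (`End⁰ ≅ K` for simple realisations).  The DEGENERATE cell
is pinned by a sandwich: a sextic CM field with a simple CM type has at most ONE imaginary quadratic subfield (`CorCM/MumfordTateRankCMThreefoldTimesCMCurvesExact`),
so exactly one curve `E_{j₀}` has its field in `K`; then `m + 4 = t(T × ⨁_{j ≠ j₀} E_j) ≤ t(X)` (monotonicity for CM products,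
`CorCM/MumfordTateRankCMProductMonotone`) and `t(X) + 1 ≤ t(E_{j₀} × T) + t(⨁_{j ≠ j₀} E_j) = 4 + (m + 1)`.

* §1 **`mtRank_hodge_one_eq_iff_of_isIsogenous_cmThreefold_prod_biproduct_cmCurves`** — `t(X) = m + 5 ↔ ∀ j, End⁰E_j ↛ End⁰T`, and `t(X) ≤ m + 5`.
* §2 the cells **`…_of_forall_isEmpty`** (`m + 5`) and **`…_of_nonempty`** (`m + 4`).

## References
* [MoonenZarhin1999LowDim] B. Moonen, Yu. G. Zarhin, *Hodge classes on abelian varieties of low dimension*, Math. Ann. 315 (1999), Thm. (0.2) (a), (4),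
  §3 (3.1), Prop. (3.8) [corpus: paper:arxiv-math_9901113 pp. 1–2, 6–7]. [cite: MoonenZarhin1999LowDim, Thm. (0.2) and §3 Prop. (3.8)]
* [Gordon1999HodgeAVSurvey] B. B. Gordon, *A survey of the Hodge conjecture for abelian varieties*, §3 Theorem (1), 7.4–7.7, 9.1.
  [cite: Gordon1999HodgeAVSurvey, 7.5 and 9.1]
* [Shimura1998] G. Shimura, *Abelian Varieties with Complex Multiplication and Modular Functions*, §5.1 Prop. 6, §8.2 Prop. 26.
  [cite: Shimura1998, §5.1 Prop. 6]
-/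

noncomputable section

open CategoryTheory CategoryTheory.Limits NumberField Module IntermediateField
open scoped BigOperators

namespace Summit.HodgeConjecture.CorCM

open Literature.NumberTheory.ComplexMultiplication
open Literature.AlgebraicGeometry.Motives
open Literature.AlgebraicGeometry.Motives.AbelianVariety
open Literature.AlgebraicGeometry.HodgeTheory
open Literature.AlgebraicGeometry.ComplexMultiplication
open Literature.AlgebraicGeometry.Milne1999 (IsOfCMType isOfCMType_iff_of_isIsogenous isIsogeny_biproduct_map)
open Literature.AlgebraicGeometry.Pohlmann1968
open Summit.HodgeConjecture.HodgeConjecture.Ring2.Atlas (nonempty_ringEquiv_endAlgebra_of_isSimple)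

variable [HodgeTensorFacts.{0, 0}] {X T : AbelianVariety ℂ} {n : ℕ} {m : ℕ} {E : Fin (m + 1) → AbelianVariety ℂ}

/-! ## §1 The realisation transport for `(T, E₀, …, E_m)` -/

/-- **Simple CM threefold × pairwise non-isogenous CM curves — the criterion.**  For `T` a simple abelian threefold of CM type, pairwise non-isogenous
CM elliptic curves `E₀, …, E_m` and `X ∼ T × ⨁E`: `t(X) = m + 5` iff there is NO ring homomorphism `End⁰E_j → End⁰T` for any `j` (b16's criterion for
the family `(Φ_T, Φ_{E₀}, …, Φ_{E_m})`, nondegeneracy read as `t = Σ dim + 1`), and `t(X) ≤ m + 5` (Kubota–Ribet bound).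
[cite: MoonenZarhin1999LowDim, Thm. (0.2) and §3 Prop. (3.8)] [cite: Gordon1999HodgeAVSurvey, 7.5 and 9.1] [cite: Shimura1998, §5.1 Prop. 6] -/
theorem mtRank_hodge_one_eq_iff_of_isIsogenous_cmThreefold_prod_biproduct_cmCurves (hX : IsSmoothProjective n X.X) (hTs : T.IsSimple)
    (hT3 : T.dim = 3) (hTcm : IsOfCMType T) (hE1 : ∀ j, (E j).dim = 1) (hEcm : ∀ j, IsOfCMType (E j))
    (hniso : ∀ i j, i ≠ j → ¬ IsIsogenous (E i) (E j)) (hXP : IsIsogenous X (T.prod (⨁ E))) :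
    haveI := BettiUniverse.finite hX 1
    ((BettiUniverse.hodge exists_isReal_hodgeModel_holds hX 1).mtRank = m + 5 ↔ ∀ j, IsEmpty ((E j).endAlgebra →+* T.endAlgebra)) ∧
      (BettiUniverse.hodge exists_isReal_hodgeModel_holds hX 1).mtRank ≤ m + 5 := by
  classical
  haveI := BettiUniverse.finite hX 1
  let F : Fin (m + 2) → AbelianVariety ℂ := Fin.cons T E
  have hF0 : F 0 = T := rfl
  have hFs' : ∀ j : Fin (m + 1), F j.succ = E j := fun j => by simp only [F, Fin.cons_succ]
  have hdimF : ∀ i, (F i).dim = if i = 0 then 3 else 1 := fun i => by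
    refine Fin.cases ?_ (fun j => ?_) i
    · rw [if_pos rfl, hF0, hT3]
    · rw [if_neg (Fin.succ_ne_zero j), hFs', hE1]
  have hFs : ∀ i, (F i).IsSimple := fun i => by
    refine Fin.cases ?_ (fun j => ?_) i
    · rw [hF0]; exact hTs
    · rw [hFs']; exact isSimple_of_dim_le_one (hE1 j).le
  have hFcm : ∀ i, IsOfCMType (F i) := fun i => by
    refine Fin.cases ?_ (fun j => ?_) i
    · rw [hF0]; exact hTcm
    · rw [hFs']; exact hEcm j
  have h0 : ∀ i, 0 < (F i).dim := fun i => by rw [hdimF i]; split_ifs <;> omega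
  have hFniso : ∀ i i', i ≠ i' → ¬ IsIsogenous (F i) (F i') := by
    intro i i' hii' h
    have hd : (F i).dim = (F i').dim := dim_eq_of_isIsogenous_holds h
    rw [hdimF, hdimF] at hd
    revert hii' h hd
    refine Fin.cases ?_ (fun j => ?_) i <;> refine Fin.cases ?_ (fun j' => ?_) i'
    · intro hii' _ _; exact hii' rfl
    · intro _ _ hd; simp [Fin.succ_ne_zero] at hd
    · intro _ _ hd; simp [Fin.succ_ne_zero] at hd
    · intro hjj' h _
      rw [hFs', hFs'] at h
      exact hniso j j' (fun e => hjj' (by rw [e])) h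
  -- realisations `F' i ∼ F i` of CM types `Φ i` on CM fields `K i` of degree `2 · dim F_i`, primitive
  have hreal := fun i => exists_realisation_mtRank_eq (AbelianVariety.isSmoothProjective_holds (A := F i)) (hFs i) (h0 i) (hFcm i)
  choose K fK nfK cmK Φ F' ι θ s₀ hspec using hreal
  have hA : ∀ i, IsCMTypeRealisation (Φ i) (F' i) (ι i) (θ i) := fun i => (hspec i).1
  have hiso : ∀ i, IsIsogenous (F i) (F' i) := fun i => (hspec i).2.1
  have hdeg : ∀ i, Module.finrank ℚ (K i) = 2 * (F i).dim := fun i => (hspec i).2.2.1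
  have hprim : ∀ i, IsPrimitive (ℂ ≃+* ℂ) (Φ i).1 (s₀ i) := fun i => (hspec i).2.2.2.1
  have hdimF' : ∀ i, (F' i).dim = (F i).dim := fun i => ((dim_eq_of_isIsogenous_holds (hiso i) : (F i).dim = (F' i).dim)).symm
  have hs : ∀ i, (F' i).IsSimple := fun i => (hFs i).of_isIsogenous (hiso i)
  have hniso' : ∀ i i', i ≠ i' → ¬ IsIsogenous (F' i) (F' i') := fun i i' hii' h =>
    hFniso i i' hii' (((hiso i).trans h).trans (hiso i').symm')
  -- `X ∼ T × ⨁E ∼ ⨁F ∼ ⨁F'`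
  obtain ⟨hs₀, g₀, hhg, hgh⟩ := AndreRiemann.biproduct_succ_split F
  have hg₀ : IsIsogeny g₀ := isIsogeny_of_comp_eq_of_comp_eq (isIsogeny_id _) (isIsogeny_id _) hhg hgh
  have hEF : IsIsogenous (⨁ E) (⨁ (F ∘ Fin.succ)) :=
    ⟨(biproduct.mapIso fun j : Fin (m + 1) => eqToIso (hFs' j).symm).hom, isIsogeny_hom_of_iso _⟩
  have hTF : IsIsogenous (T.prod (⨁ E)) (⨁ F) := ((IsIsogenous.refl T).prod hEF).trans ⟨g₀, hg₀⟩
  have hXB : IsIsogenous X (⨁ fun j => F' (id j)) := by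
    choose g hg using fun j => hiso j
    exact (hXP.trans hTF).trans ⟨biproduct.map g, isIsogeny_biproduct_map hg⟩
  -- nondegeneracy ↔ `t = Σ dim + 1 = m + 5`
  have hrank := isNondegenerateFamily_iff_mtRank_hodge_one_eq hA Function.surjective_id hX hXB
  have hsum : ∑ i, (F' i).dim = m + 4 := by
    rw [Finset.sum_congr rfl fun i _ => hdimF' i, Fin.sum_univ_succ, hdimF, if_pos rfl,
      Finset.sum_congr rfl fun j _ => by rw [hdimF, if_neg (Fin.succ_ne_zero j)]]
    simp
    omega
  rw [hsum, show (m + 4 + 1 : ℕ) = m + 5 by ring] at hrank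
  -- b16's criterion with `b = 0`
  have h2 : ∀ j : Fin (m + 2), j ≠ 0 → Module.finrank ℚ (K j) = 2 := fun j hj => by
    rw [hdeg j, hdimF j, if_neg hj]
  have hsep : CMAlgebra.IsSeparatingFamily (fun j : {j : Fin (m + 2) // j ≠ 0} => Φ j.1) :=
    CMAlgebra.isSeparatingFamily_of_isSimple_of_pairwise_not_isIsogenous (fun j => hA j.1) (fun j => hs j.1)
      (fun j j' hjj' => hniso' j.1 j'.1 (fun h => hjj' (Subtype.ext h)))
  have h6 : Module.finrank ℚ (K 0) ≤ 6 := by rw [hdeg 0, hdimF 0, if_pos rfl]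
  have hcrit := isNondegenerateFamily_iff_forall_isEmpty_of_finrank_le_six (0 : Fin (m + 2)) Φ h2 hsep h6 (s₀ 0) (hprim 0)
  -- the dictionary `K i ≃ End⁰(F' i) ≃ End⁰(F i)`
  have hKF : ∀ i, Nonempty (K i ≃+* (F i).endAlgebra) := fun i => by
    obtain ⟨e⟩ := nonempty_ringEquiv_endAlgebra_of_isSimple (hA i) (hs i)
    obtain ⟨a⟩ := (hiso i).nonempty_endAlgebra_algEquiv
    exact ⟨e.trans a.symm.toRingEquiv⟩
  have htrans : ∀ a : Fin (m + 2), IsEmpty (K a →+* K 0) ↔ IsEmpty ((F a).endAlgebra →+* T.endAlgebra) := fun a =>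
    isEmpty_ringHom_iff_of_ringEquiv (hKF a).some (hKF 0).some
  refine ⟨?_, ?_⟩
  · rw [← hrank, hcrit]
    constructor
    · intro h j
      have hj := (htrans j.succ).1 (h j.succ (Fin.succ_ne_zero j))
      rwa [hFs'] at hj
    · intro h a ha
      obtain ⟨j, rfl⟩ := Fin.eq_succ_of_ne_zero ha
      refine (htrans j.succ).2 ?_
      rw [hFs']
      exact h j
  · haveI : Nonempty (Fin (m + 2)) := ⟨0⟩
    have h := mtRank_hodge_one_le_sum_dim_add_one_of_isIsogenous_biproduct hA Function.surjective_id hX hXB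
    rw [hsum] at h
    omega

/-! ## §2 The cells -/

/-- **`t(T × E₀ × ⋯ × E_m) = m + 5`** for a simple abelian threefold `T` of CM type and pairwise non-isogenous CM elliptic curves none of whose fields maps
to `End⁰T` (`Hg` = a torus of rank `3 + (m + 1)`: the family is nondegenerate). [cite: MoonenZarhin1999LowDim, Thm. (0.2) and §3 Prop. (3.8)] -/
theorem mtRank_hodge_one_eq_of_isIsogenous_cmThreefold_prod_biproduct_cmCurves_of_forall_isEmpty (hX : IsSmoothProjective n X.X) (hTs : T.IsSimple)
    (hT3 : T.dim = 3) (hTcm : IsOfCMType T) (hE1 : ∀ j, (E j).dim = 1) (hEcm : ∀ j, IsOfCMType (E j))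
    (hniso : ∀ i j, i ≠ j → ¬ IsIsogenous (E i) (E j)) (hfor : ∀ j, IsEmpty ((E j).endAlgebra →+* T.endAlgebra))
    (hXP : IsIsogenous X (T.prod (⨁ E))) :
    haveI := BettiUniverse.finite hX 1
    (BettiUniverse.hodge exists_isReal_hodgeModel_holds hX 1).mtRank = m + 5 :=
  (mtRank_hodge_one_eq_iff_of_isIsogenous_cmThreefold_prod_biproduct_cmCurves hX hTs hT3 hTcm hE1 hEcm hniso hXP).1.2 hfor

/-- **`t(T × E₀ × ⋯ × E_m) = m + 4`** for a simple abelian threefold `T` of CM type, pairwise non-isogenous CM elliptic curves, and SOME `E_{j₀}` with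
`End⁰E_{j₀} ↪ End⁰T`: the other curves have `End⁰E_j ↛ End⁰T` (a sextic CM field with a simple type has at most one imaginary quadratic subfield;
curves with a ring homomorphism between their fields are isogenous), so `m + 4 = t(T × ⨁_{j ≠ j₀} E_j) ≤ t(X)` (monotonicity for CM products) and
`t(X) + 1 ≤ t(E_{j₀} × T) + t(⨁_{j ≠ j₀} E_j) = 4 + (m + 1)`. [cite: MoonenZarhin1999LowDim, Thm. (0.2) and §3 Prop. (3.8)] [cite: Gordon1999HodgeAVSurvey, 7.5 and 9.1] -/
theorem mtRank_hodge_one_eq_of_isIsogenous_cmThreefold_prod_biproduct_cmCurves_of_nonempty (hX : IsSmoothProjective n X.X) (hTs : T.IsSimple)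
    (hT3 : T.dim = 3) (hTcm : IsOfCMType T) (hE1 : ∀ j, (E j).dim = 1) (hEcm : ∀ j, IsOfCMType (E j))
    (hniso : ∀ i j, i ≠ j → ¬ IsIsogenous (E i) (E j)) {j₀ : Fin (m + 1)} (hj₀ : Nonempty ((E j₀).endAlgebra →+* T.endAlgebra))
    (hXP : IsIsogenous X (T.prod (⨁ E))) :
    haveI := BettiUniverse.finite hX 1
    (BettiUniverse.hodge exists_isReal_hodgeModel_holds hX 1).mtRank = m + 4 := by
  classical
  haveI := BettiUniverse.finite hX 1
  -- the other curves have fields not mapping to `K`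
  have hfor : ∀ j, j ≠ j₀ → IsEmpty ((E j).endAlgebra →+* T.endAlgebra) := by
    intro j hj
    by_contra hne
    rw [not_isEmpty_iff] at hne
    exact hniso j₀ j (Ne.symm hj) (isIsogenous_of_cmCurves_of_nonempty_ringHom_of_isSimple_of_odd (hE1 j₀) (hEcm j₀) (hE1 j) (hEcm j) hTs hTcm
      (by rw [hT3]; exact ⟨1, rfl⟩) hj₀ hne)
  have hET : IsSmoothProjective ((E j₀).prod T).dim ((E j₀).prod T).X := AbelianVariety.isSmoothProjective_holds
  haveI := BettiUniverse.finite hET 1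
  have h4 := (mtRank_hodge_one_eq_four_iff_nonempty_ringHom_of_isIsogenous_cmCurve_prod_isSimple_cmThreefold hET (hE1 j₀) (hEcm j₀) hTs hT3 hTcm
    (IsIsogenous.refl _)).2 hj₀
  cases m with
  | zero =>
    have hB : IsIsogenous (⨁ E) (E j₀) := isIsogenous_biproduct_of_forall_eq E j₀ fun j => Fin.ext (by have := j.2; have := j₀.2; omega)
    have hXQ : IsIsogenous X ((E j₀).prod T) := (hXP.trans ((IsIsogenous.refl T).prod hB)).trans (isIsogenous_prod_comm T (E j₀))
    rw [Literature.AlgebraicGeometry.Pohlmann1968.mtRank_hodge_one_eq_of_isIsogenous hX hET hXQ, h4]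
  | succ m' =>
    -- split `E_{j₀}` off and reindex the rest by `Fin (m' + 1)`
    let e : Fin (m' + 1) ≃ {j // j ≠ j₀} := finSuccAboveEquiv j₀
    let E' : Fin (m' + 1) → AbelianVariety ℂ := (fun j : {j // j ≠ j₀} => E j.1) ∘ e
    have hsub : IsIsogenous (⨁ fun j : {j // j ≠ j₀} => E j.1) (⨁ E') :=
      ⟨(biproduct.reindex e (fun j : {j // j ≠ j₀} => E j.1)).inv, isIsogeny_hom_of_iso (biproduct.reindex e _).symm⟩
    have hE'1 : ∀ i, (E' i).dim = 1 := fun i => hE1 _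
    have hE'cm : ∀ i, IsOfCMType (E' i) := fun i => hEcm _
    have hE'niso : ∀ i i', i ≠ i' → ¬ IsIsogenous (E' i) (E' i') := fun i i' hii' =>
      hniso _ _ fun h => hii' (e.injective (Subtype.ext h))
    have hE'for : ∀ i, IsEmpty ((E' i).endAlgebra →+* T.endAlgebra) := fun i => hfor _ (e i).2
    have hY : IsSmoothProjective (T.prod (⨁ E')).dim (T.prod (⨁ E')).X := AbelianVariety.isSmoothProjective_holds
    have hY' : IsSmoothProjective (⨁ E').dim (⨁ E').X := AbelianVariety.isSmoothProjective_holds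
    haveI := BettiUniverse.finite hY 1
    haveI := BettiUniverse.finite hY' 1
    have hY5 := mtRank_hodge_one_eq_of_isIsogenous_cmThreefold_prod_biproduct_cmCurves_of_forall_isEmpty hY hTs hT3 hTcm hE'1 hE'cm hE'niso hE'for
      (IsIsogenous.refl _)
    -- lower bound: `X ∼ (T × ⨁E') × E_{j₀}`, all of CM type
    have hXQ : IsIsogenous X ((T.prod (⨁ E')).prod (E j₀)) :=
      (hXP.trans ((IsIsogenous.refl T).prod ((isIsogenous_biproduct_prod_erase E j₀).trans (hsub.prod (IsIsogenous.refl _))))).trans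
        (Literature.AlgebraicGeometry.HodgeTheory.isIsogenous_prod_assoc T (⨁ E') (E j₀)).symm'
    have hE₀ : IsSmoothProjective (E j₀).dim (E j₀).X := AbelianVariety.isSmoothProjective_holds
    haveI := BettiUniverse.finite hE₀ 1
    have hY0 : 0 < (T.prod (⨁ E')).dim := by rw [dim_prod]; omega
    have hXcm : IsOfCMType X := by
      refine (isOfCMType_iff_of_isIsogenous hXQ).2 ((hTcm.prod (RankFourWeil.isOfCMType_biproduct_fin E' hE'cm)).prod (hEcm j₀))
    have hge := (mtRank_hodge_one_le_of_isIsogenous_prod_of_isOfCMType hX hY hY0 hE₀ (by rw [hE1]; exact one_pos) hXcm hXQ).1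
    -- upper bound: `X ∼ (E_{j₀} × T) × ⨁E'`, `t(E_{j₀} × T) = 4`, `t(⨁E') = m' + 2`
    have hXR : IsIsogenous X (((E j₀).prod T).prod (⨁ E')) :=
      (hXQ.trans (isIsogenous_prod_comm _ _)).trans
        ((Literature.AlgebraicGeometry.HodgeTheory.isIsogenous_prod_assoc (E j₀) T (⨁ E')).symm')
    have hK := mtRank_hodge_one_eq_card_add_one_of_isIsogenous_biproduct_elliptic (C := Fin (m' + 1)) hE'1 hE'cm hE'niso (cls := id)
      Function.surjective_id hY' (IsIsogenous.refl _)
    rw [Fintype.card_fin] at hK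
    have hle := mtRank_hodge_one_add_one_le_add_of_isIsogenous_prod hET hY' (by rw [dim_prod]; omega)
      (by rw [AndreRiemann.dim_biproduct_fin]; exact Finset.sum_pos (fun j _ => by rw [hE'1]; exact one_pos) Finset.univ_nonempty) hX hXR
    omega

end Summit.HodgeConjecture.CorCM

end
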